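import Literature.MathematicalPhysics.QuantumFieldTheory.Balaban1983to89.B15Prop1LocalLettersRecord
import Literature.MathematicalPhysics.QuantumFieldTheory.Balaban1983to89.B15Prop1AnalyticExtClause

/-!
# `Balaban1983to89.B15Prop1AnalyticExtAtRecord` — [Balaban1989LargeFieldI] Prop. 1 p. 194, LAST CLAUSE AT THE RECORD: the LOCAL endpoint of the
# N12∕s1 chain with the analytic-extension slot `An` INSTANTIATED by the typed clause `B15Prop1AnalyticExtClause.anExt` and its letter `hAn`
# DISCHARGED from the complex model ([Balaban1989LargeFieldII] p. 359 *«valid for 𝔤ᶜ-valued fields, hence the existence of the analytic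
# extension follows immediately»*, r13's `B16Prop1IVFromProp4.prop1IV_complex` BY NAME)

statement-level skeleton of published theorems with citation tags; proofs where landed; nothing here is a claim about
the Yang–Mills mass gap

Cell pub-ymgap, HUMAN RULING D-0062 (Track A full width), seat `pub-ymgap-dag-n12-c` (R134 acceleration seat (a), DAG node N12 = [B15]; generation g4,
tenth product; dag-lead REBALANCE №68 «(x) the analytic-extension clause»).

WHAT THIS FILE PROVES (no `sorry`, no definition, no `… : Prop` fact; axioms standard).  ★★★
**`exists_domain_prop1Printed_lfVarOn_std_su2_box_analytic`** = `B15Prop1LocalLettersRecord.exists_domain_prop1Printed_lfVarOn_std_su2_box_regular`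
(p501043) with `An i := anExt (pts (k i) (Λ i)) (T i) (fun177std bg M₁ (Z i) (k i)) (ext i) (r i)` — Proposition 1's clause *«The orbit-valued function
V_Λ(V_k↾_{Z∩Λᶜ}) has an analytic extension for Gᶜ-valued configurations … B′ ∈ 𝔤ᶜ and small, |B′| < ε»* NO LONGER CARRIED AS A FREE PREDICATE — and
the letter `hAn` REPLACED by the complexified pieces of record at each `eA`-regular datum (`eA ≤ eR`): the complexified operators `Hc`∕`Hstc`∕`Δ₁c`
intertwining the real ones along `cplxSlice` ∕ the (now ℝ-linear, totally real) `emb`, the complex (1.9) `hposc` (constant `γ∕M⁵`), norms `h₁`, room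
`h₁·3r ≤ ρ`, the real current family `Jp i V_k p` of the perturbed data with the (c3)∕(m5)-shape letter `hc3p` (criticality of
`exp(i·ιA B)·ext(exp(ip)V_k)` ⇔ the real (1.12) with `(H, Δ₁, dV, Jp p)` — r13's fixed-operator reading), and the complexified current `Jc`
analytic on `‖p̃‖ < eA`, small there, real-compatible (`Jc (cplxVec p) = emb (Jp p)`).  Proof: `hAn` := `anExt_antitone` ∘
`B15Prop1AnalyticExtClause.anExt_of_complexModel`; the chain's `hemb`∕`hemb0` derived from `hembI`.

HONEST SCOPE.  (i) The complexified data are NODE 00's (displayed, not built); `W`, `Prop4Hyp W`, `hWdV` were already the chain's (m3) data.  (ii) r13's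
reading is displayed in `hc3p`; a datum-dependent `H_{1,k}` would need the parametric analytic implicit-function theorem.  (iii) `SU(2)`, parallelepipeds,
`d ≥ 3`, `r ≤ 1/2`.  Count-neutral; NOT a discharge of N12; NOT summit progress; nothing continuum ∕ OS ∕ mass-gap ∕ Clay.
-/

noncomputable section

open Set Finset
open scoped BigOperators Matrix RealInnerProductSpace Real InnerProductSpace

namespace Literature.MathematicalPhysics.QuantumFieldTheory.Balaban1983to89.B15Prop1AnalyticExtAtRecord

open B15DeterminingSets GaugeField B16Sect1Backgrounds B15Prop1Carrier B8Eq17ClassAkV1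
open B15Prop1CarrierOnSU2Box B15Prop1SliceIneq18 B15Prop1CarrierOnSU2BoxIneq19 B15Prop1CarrierOnSU2BoxExt193 B15Prop1SliceIneq167
open B15Prop1StdInstanceSU2Box B15Prop1LipschitzFromProp4 B15Prop1AdjointOfRecord B15Prop1CriticalViaSlice B15Prop1ChartCalculusSU2
open B15Prop1CriticalAtBoxG0 B15Prop1ChartRecentering B15Prop1LocalLettersModel B15Prop1LocalLettersSU2Box B15Prop1LocalLettersRecord
open B15Prop1AnalyticExtClause
open T4CubeChartGnomonic (SU2)
open B15Prop1ChartSU2 (su2Chart)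
open B15Prop1SliceCoordinates (GaugeSlice ιA freeBonds norm_ιA_apply_le)
open T4AxialGaugeSmallField (castSite boxPlaqs)
open B7Prop1Explicit (e e_apply)
open B6BondElimination (unitVec unitVec_apply)
open B6TreeGaugePoincare (curl)
open B16Eq18Proof (box mem_box)
open B15Extension193 (extend)
open B15ShellGauge193 (shellGauge)
open B5Prop11Plancherel (Tor)
open B5Bounds167Lattice (formDk ofRealCfg)
open B14.Eq213DetSet B14.Eq216Concrete B14.Eq12InteriorLocality B15Sect1Instances B15Eq177GaugeInvariance
open Literature.MathematicalPhysics.QuantumFieldTheory.BalabanImbrieJaffe1984to88.BIJ85Eq453GaugeField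
open B11Prop6Scheme (Prop4Hyp)

section Knit

open Classical

variable {P : Params}

/-- ★★★ **PROPOSITION 1 [IV] AT THE CARRIER OF RECORD WITH ITS ANALYTIC-EXTENSION CLAUSE TYPED AND DISCHARGED FROM THE COMPLEX MODEL** (LOCAL
letters).  See the module docstring. [cite: Balaban1989LargeFieldI, Prop. 1 (1.77)–(1.78) p.194 (incl. the last clause), p.193; Balaban1989LargeFieldII,
pp.357–359, (1.12)–(1.13); Balaban1985Variational, Prop. 4 pp.292–293, (181) p.307, (190) p.308] -/
theorem exists_domain_prop1Printed_lfVarOn_std_su2_box_analytic (hd3 : 3 ≤ P.d) (h0 : 0 < P.d) {ι : Type}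
    {av : ∀ j, Averaging P j SU2}
    (bg : DetBackground P SU2 av) (M₁ : ℕ) (Z Λ : ι → Set (Site P 0)) (k : ι → ℕ) (M : ι → ℝ)
    (hk : ∀ i, k i ≤ P.m + P.K)
    (eR : ι → ℝ) (heR : ∀ i, 0 < eR i)
    (h181 : ∀ i (u : GaugeTransf P (k i) SU2), Cov181 bg (Bj M₁ (Z i) (k i)) (blockLift (k i) u))
    (T : ∀ i, Finset (PBond P (k i)))
    {F : ι → Type*} [∀ i, NormedAddCommGroup (F i)] [∀ i, InnerProductSpace ℝ (F i)] [∀ i, FiniteDimensional ℝ (F i)]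
    (H : ∀ i, GaugeField P (k i) SU2 →
      (GaugeSlice (pts (k i) (Λ i)) (T i) (EuclideanSpace ℝ (Fin 3)) →ₗ[ℝ] F i))
    (Δ₁ : ∀ i, GaugeField P (k i) SU2 → (F i →ₗ[ℝ] F i)) (dV : ∀ i, GaugeField P (k i) SU2 → F i → F i)
    {Fc : ι → Type*} [∀ i, NormedAddCommGroup (Fc i)] [∀ i, InnerProductSpace ℂ (Fc i)] [∀ i, CompleteSpace (Fc i)]
    -- the complexification embedding is now ℝ-LINEAR and TOTALLY REAL (its isometry and `emb 0 = 0` are consequences)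
    (emb : ∀ i, F i →ₗ[ℝ] Fc i) (hembI : ∀ i (u v : F i), ⟪emb i u, emb i v⟫_ℂ = ((⟪u, v⟫_ℝ : ℝ) : ℂ))
    (W : ∀ i, GaugeField P (k i) SU2 → Fc i → Fc i) {C₄ a₃ a : ι → ℝ} (hC₄ : ∀ i, 0 ≤ C₄ i) (ha : ∀ i, 0 < a i)
    (hW : ∀ i Vk, PlaqSmallOn (plaqsInside (pts (k i) (Z i ∩ (Λ i)ᶜ))) (eR i) Vk → Prop4Hyp (W i Vk) (C₄ i) (a₃ i)) (hWdV : ∀ i Vk (u : F i), W i Vk (emb i u) = emb i (dV i Vk u))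
    (J : ∀ i, GaugeField P (k i) SU2 → F i)
    (lo hi : ι → Fin P.d → ℤ) (n : ι → ℕ) (hn : ∀ i κ, hi i κ ≤ lo i κ + n i) (hN : ∀ i, n i + 2 < P.sitesPerDir (k i))
    (hbox : ∀ i, pts (k i) (Λ i) = (castSite '' Set.Icc (lo i) (hi i) : Set (Site P (k i))))
    (hZ : ∀ i, (boxPlaqs (lo i - 1) (hi i + 1) : Set (Plaq P (k i))) ⊆ plaqsInside (pts (k i) (Z i)))
    (hTG0 : ∀ i, T i = (box (fun κ => (hi i κ - lo i κ + 1).toNat) (lo i)).image fun x =>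
      (⟨castSite (x - unitVec ⟨0, h0⟩), ⟨0, h0⟩⟩ : PBond P (k i)))
    (hN5 : ∀ i κ, ((hi i κ - lo i κ + 1).toNat : ℤ) + 5 < P.sitesPerDir (k i))
    (K : ι → ℕ) (hK1 : ∀ i, 1 ≤ K i) (hKn : ∀ i κ, (hi i κ - lo i κ + 1).toNat ≤ K i)
    (ext : ∀ i, GaugeField P (k i) SU2 → GaugeField P (k i) SU2)
    (hext : ∀ i Vk, ext i Vk = extend (pts (k i) (Λ i)) (shellGauge Vk (lo i) (hi i)) Vk)
    (hlohi : ∀ i, lo i ≤ hi i)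
    {γ h₁ cJ bx : ℝ} (hγ : 0 < γ) (hh₁ : 0 ≤ h₁) (hcJ : 0 ≤ cJ) (hbx : 0 ≤ bx)
    (hbxM : ∀ i, 12 * (P.d : ℝ) * ((n i : ℝ) + 2) ^ 2 ≤ bx * (M i) ^ 2)
    {ρ r eA Cerr : ι → ℝ} (hr : ∀ i, 0 < r i) (heA : ∀ i, 0 < eA i) (hM : ∀ i, 1 ≤ (M i))
    (n' : ι → ℕ) (hn' : ∀ i, 1 ≤ n' i)
    (hlead : ∀ i Vk, PlaqSmallOn (plaqsInside (pts (k i) (Z i ∩ (Λ i)ᶜ))) (eR i) Vk → ∀ X : GaugeSlice (pts (k i) (Λ i)) (T i) (EuclideanSpace ℝ (Fin 3)),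
      |⟪H i Vk X, Δ₁ i Vk (H i Vk X)⟫ -
          ∑ a : Fin 3, formDk (n' i) (fun _ : Fin P.d => P.sitesPerDir (k i))
            (ofRealCfg (fun _ : Fin P.d => P.sitesPerDir (k i)) fun j =>
              ιA (pts (k i) (Λ i)) (T i) X ⟨j.1, j.2⟩ a)| ≤ Cerr i * ‖X‖ ^ 2)
    (hsm : ∀ i, Cerr i ≤ (4 / Real.pi ^ 2) ^ (P.d + 2) / (2 * (3 * (K i : ℝ) ^ 2 + 2 * (K i : ℝ) ^ 4)))
    (hγle : ∀ i, γ / (M i) ^ 5 ≤ (4 / Real.pi ^ 2) ^ (P.d + 2) / (2 * (3 * (K i : ℝ) ^ 2 + 2 * (K i : ℝ) ^ 4)))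
    (hH : ∀ i Vk, PlaqSmallOn (plaqsInside (pts (k i) (Z i ∩ (Λ i)ᶜ))) (eR i) Vk → ∀ x, ‖H i Vk x‖ ≤ h₁ * ‖x‖)
    (hρ : ∀ i, h₁ * r i ≤ ρ i) (ha₃ : ∀ i, 2 * (ρ i + a i) ≤ a₃ i)
    (hsmall : ∀ i, (M i) ^ 5 / γ * h₁ * (4 * C₄ i * (ρ i + a i)) * h₁ ≤ 1 / 2)
    (hA : ∀ i Vk, PlaqSmallOn (plaqsInside (pts (k i) (Z i ∩ (Λ i)ᶜ))) (eR i) Vk → ∀ X δ : GaugeSlice (pts (k i) (Λ i)) (T i) (EuclideanSpace ℝ (Fin 3)), ‖X‖ ≤ r i →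
      HasDerivAt (fun s : ℝ => (fun177std bg M₁ (Z i) (k i)) (expMul su2Chart (ιA (pts (k i) (Λ i)) (T i) (X + s • δ)) (ext i Vk)))
      (⟪H i Vk δ, J i Vk⟫ + ⟪H i Vk δ, Δ₁ i Vk (H i Vk X)⟫ + ⟪H i Vk δ, dV i Vk (H i Vk X)⟫) 0)
    (hJ : ∀ i ε Vk, 0 < ε → PlaqSmallOn (plaqsInside (pts (k i) (Z i ∩ (Λ i)ᶜ))) ε Vk → ‖J i Vk‖ ≤ cJ * ε)
    -- (c3) and `hF` DERIVED; the differentiability letter is about print's function of `B′`, at the chart points of the ball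
    (hG : ∀ i Vk, PlaqSmallOn (plaqsInside (pts (k i) (Z i ∩ (Λ i)ᶜ))) (eR i) Vk → ∀ B : GaugeSlice (pts (k i) (Λ i)) (T i) (EuclideanSpace ℝ (Fin 3)), ‖B‖ ≤ r i →
      DifferentiableAt ℝ (fun B' : VecField P (k i) (EuclideanSpace ℝ (Fin 3)) =>
        (fun177std bg M₁ (Z i) (k i)) (expMul su2Chart B' (ext i Vk))) (ιA (pts (k i) (Λ i)) (T i) B))
    (hr2 : ∀ i, r i ≤ 1 / 2)
    -- (x) THE ANALYTIC-EXTENSION CLAUSE DISCHARGED from the complex model at each `eA`-regular datum (`eA ≤ eR`)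
    (heAR : ∀ i, eA i ≤ eR i) (hρpos : ∀ i, 0 < ρ i) (hρ3 : ∀ i, h₁ * (3 * r i) ≤ ρ i)
    (Hc : ∀ i, GaugeField P (k i) SU2 → (GaugeSlice (pts (k i) (Λ i)) (T i) (EuclideanSpace ℂ (Fin 3)) →L[ℂ] Fc i))
    (Hstc : ∀ i, GaugeField P (k i) SU2 → (Fc i →L[ℂ] GaugeSlice (pts (k i) (Λ i)) (T i) (EuclideanSpace ℂ (Fin 3))))
    (hadjc : ∀ i Vk (x : GaugeSlice (pts (k i) (Λ i)) (T i) (EuclideanSpace ℂ (Fin 3))) (y : Fc i), ⟪Hc i Vk x, y⟫_ℂ = ⟪x, Hstc i Vk y⟫_ℂ)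
    (Δ₁c : ∀ i, GaugeField P (k i) SU2 → (Fc i →L[ℂ] Fc i))
    (hHc : ∀ i Vk (X : GaugeSlice (pts (k i) (Λ i)) (T i) (EuclideanSpace ℝ (Fin 3))), Hc i Vk (cplxSlice (pts (k i) (Λ i)) (T i) X) = emb i (H i Vk X))
    (hΔc : ∀ i Vk (u : F i), Δ₁c i Vk (emb i u) = emb i (Δ₁ i Vk u))
    (hposc : ∀ i Vk, PlaqSmallOn (plaqsInside (pts (k i) (Z i ∩ (Λ i)ᶜ))) (eA i) Vk → ∀ x : GaugeSlice (pts (k i) (Λ i)) (T i) (EuclideanSpace ℂ (Fin 3)),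
      γ / (M i) ^ 5 * ‖x‖ ^ 2 ≤ RCLike.re ⟪Hc i Vk x, Δ₁c i Vk (Hc i Vk x)⟫_ℂ)
    (hHcn : ∀ i Vk, PlaqSmallOn (plaqsInside (pts (k i) (Z i ∩ (Λ i)ᶜ))) (eA i) Vk → ∀ x : GaugeSlice (pts (k i) (Λ i)) (T i) (EuclideanSpace ℂ (Fin 3)), ‖Hc i Vk x‖ ≤ h₁ * ‖x‖)
    (hHstcn : ∀ i Vk, PlaqSmallOn (plaqsInside (pts (k i) (Z i ∩ (Λ i)ᶜ))) (eA i) Vk → ∀ z : Fc i, ‖Hstc i Vk z‖ ≤ h₁ * ‖z‖)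
    (Jp : ∀ i, GaugeField P (k i) SU2 → VecField P (k i) (EuclideanSpace ℝ (Fin 3)) → F i)
    (hc3p : ∀ i Vk, PlaqSmallOn (plaqsInside (pts (k i) (Z i ∩ (Λ i)ᶜ))) (eA i) Vk → ∀ p : VecField P (k i) (EuclideanSpace ℝ (Fin 3)), ‖p‖ < eA i →
      ∀ B : GaugeSlice (pts (k i) (Λ i)) (T i) (EuclideanSpace ℝ (Fin 3)), ‖B‖ ≤ r i →
        (IsCriticalPt su2Chart (bondsOf (pts (k i) (Λ i))) (fun177std bg M₁ (Z i) (k i))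
            (expMul su2Chart (ιA (pts (k i) (Λ i)) (T i) B) (ext i (expMul su2Chart p Vk))) ↔
          ∀ δ : GaugeSlice (pts (k i) (Λ i)) (T i) (EuclideanSpace ℝ (Fin 3)), ⟪H i Vk δ, Jp i Vk p⟫_ℝ + ⟪H i Vk δ, Δ₁ i Vk (H i Vk B)⟫_ℝ + ⟪H i Vk δ, dV i Vk (H i Vk B)⟫_ℝ = 0))
    (Jc : ∀ i, GaugeField P (k i) SU2 → VecField P (k i) (EuclideanSpace ℂ (Fin 3)) → Fc i)
    (hJc : ∀ i Vk (p : VecField P (k i) (EuclideanSpace ℝ (Fin 3))), Jc i Vk (cplxVec p) = emb i (Jp i Vk p))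
    (hJcA : ∀ i Vk, PlaqSmallOn (plaqsInside (pts (k i) (Z i ∩ (Λ i)ᶜ))) (eA i) Vk → AnalyticOnNhd ℂ (Jc i Vk) (Metric.ball 0 (eA i)))
    (hJcr : ∀ i Vk, PlaqSmallOn (plaqsInside (pts (k i) (Z i ∩ (Λ i)ᶜ))) (eA i) Vk → ∀ q : VecField P (k i) (EuclideanSpace ℂ (Fin 3)), ‖q‖ < eA i →
      (γ / (M i) ^ 5)⁻¹ * h₁ * ‖Jc i Vk q‖ < r i)
    : ∃ a₁ : ι → ℝ, (∀ i, 0 < a₁ i) ∧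
      B15.Prop1Printed (lfVarOn su2Chart fun i => InstOn.std bg M₁ (Z i) (Λ i) (k i) (M i) (a₁ i)
        (anExt (pts (k i) (Λ i)) (T i) (fun177std bg M₁ (Z i) (k i)) (ext i) (r i))) := by
  have hemb : ∀ i (u v : F i), ‖emb i u - emb i v‖ = ‖u - v‖ := by
    intro i u v
    have hsq : ∀ w : F i, ‖emb i w‖ ^ 2 = ‖w‖ ^ 2 := fun w => by
      have h1 : (‖emb i w‖ ^ 2 : ℝ) = RCLike.re ⟪emb i w, emb i w⟫_ℂ := by
        rw [← inner_self_eq_norm_sq (𝕜 := ℂ)]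
      rw [h1, hembI, real_inner_self_eq_norm_sq]; norm_cast
    have h := hsq (u - v)
    rw [map_sub] at h
    nlinarith [norm_nonneg (emb i u - emb i v), norm_nonneg (u - v), sq_nonneg (‖emb i u - emb i v‖ - ‖u - v‖),
      sq_nonneg (‖emb i u - emb i v‖ + ‖u - v‖)]
  have hemb0 : ∀ i, (emb i) 0 = 0 := fun i => map_zero _
  refine exists_domain_prop1Printed_lfVarOn_std_su2_box_regular hd3 h0 bg M₁ Z Λ k M
    (fun i => anExt (pts (k i) (Λ i)) (T i) (fun177std bg M₁ (Z i) (k i)) (ext i) (r i)) hk eR heR h181 T H Δ₁ dV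
    (fun i => ⇑(emb i)) hemb hemb0 W hC₄ ha hW hWdV J lo hi n hn hN hbox hZ hTG0 hN5 K hK1 hKn ext hext hlohi hγ hh₁ hcJ hbx hbxM hr
    heA hM n' hn' hlead hsm hγle hH hρ ha₃ hsmall hA hJ hG hr2 ?_
  intro i ε Vk hε hεA hreg
  have hregA : PlaqSmallOn (plaqsInside (pts (k i) (Z i ∩ (Λ i)ᶜ))) (eA i) Vk := fun p hp => (hreg p hp).trans_le hεA
  have hregR : PlaqSmallOn (plaqsInside (pts (k i) (Z i ∩ (Λ i)ᶜ))) (eR i) Vk := fun p hp => (hregA p hp).trans_le (heAR i)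
  have hM0 : 0 < M i := lt_of_lt_of_le one_pos (hM i)
  have hc : 0 < γ / (M i) ^ 5 := div_pos hγ (pow_pos hM0 5)
  have hsm1 : (γ / (M i) ^ 5)⁻¹ * h₁ * (4 * C₄ i * (ρ i + a i)) * h₁ ≤ 1 / 2 := by rw [inv_div]; exact hsmall i
  refine anExt_antitone hεA ?_
  exact anExt_of_complexModel (fun177std bg M₁ (Z i) (k i)) (ext i) Vk (H i Vk) (Δ₁ i Vk) (dV i Vk) (Jp i Vk)
    (hc3p i Vk hregA) (emb i) (hembI i) (Hc i Vk) (Hstc i Vk) (hadjc i Vk) (Δ₁c i Vk) (W i Vk) (hHc i Vk) (hΔc i Vk)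
    (hWdV i Vk) hc (hposc i Vk hregA) (hW i Vk hregR) (hC₄ i) hh₁ hh₁ (hρpos i) (ha i) (ha₃ i) (hHcn i Vk hregA)
    (hHstcn i Vk hregA) (hρ3 i) hsm1 (Jc i Vk) (hJc i Vk) (hJcA i Vk hregA) (hJcr i Vk hregA)

end Knit

end Literature.MathematicalPhysics.QuantumFieldTheory.Balaban1983to89.B15Prop1AnalyticExtAtRecord

end
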